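import Mathlib
import Literature.Combinatorics.Additive.TripleProductProperty
import Literature.Combinatorics.Additive.TPPGroupAlgebra
import Summits.MatrixMultiplication.MatrixMultiplication.Theorems.SnSubsetDichotomyUmvirateDescent

/-!
# `SnSubsetDichotomy.GlobalBranch` — block descent, the SETWISE analogue of `UmvirateDescent`
(stubs `stub_blockDescent`, `stub_blockPacking` of crux stmt-MatrixMultiplication-8303, seat c4)

Registered by the lead of seat c4 as tools for a successor line of crux `SnSubsetDichotomy.GlobalBranch`
(`Cruxes/GlobalBranch/Lines/bregman-entropy-window.dead.md` §5(D)); they are NOT consumed by the current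
skeleton's `GlobalBranch_of` (v8).  The route's global/junta dichotomy descends only along POINTWISE
umvirates `{σ : σ ∘ I = L}` (support `UmvirateDescent`, landing in `𝔖_{n−t}`); the configurations on
which neither branch acts — sub-triples of three pairwise crossing coarse Young cosets — are SETWISE
concentrations `{σ : σ(P) = B}`, whose descent lands in `Perm B × Perm Bᶜ ≅ 𝔖_k × 𝔖_{n−k}`.  This file
proves that descent (`blockDescent`: filter, right-translate so that the source blocks become the common
target `B`, pull back along the block embedding `Equiv.Perm.subtypeCongrHom`, using the abstract
pull-back `exists_tripleProductProperty_pullback` landed with `UmvirateDescent`) and the packing bound it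
yields (`blockPacking`): three block pieces of a TPP triple with a COMMON target block `B`, `|B| = k`, have
`(volume)² ≤ (k!(n−k)!)³`.  No named facts; unconditional.
-/

set_option linter.dupNamespace false
set_option autoImplicit false

namespace Summit.MatrixMultiplication.MatrixMultiplication.Theorems.GlobalBranch

open Literature.Combinatorics.Additive

/-- A permutation mapping the block `B` onto itself (as a `Finset.map`) lies in the range of the
block embedding `Perm B × Perm Bᶜ →* Perm (Fin n)` (`Equiv.Perm.subtypeCongrHom`). [folklore] -/
theorem mem_range_subtypeCongrHom_of_map_eq {n : ℕ} (B : Finset (Fin n)) (π : Equiv.Perm (Fin n))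
    (hπ : B.map π.toEmbedding = B) :
    π ∈ Set.range (Equiv.Perm.subtypeCongrHom (· ∈ B)) := by
  classical
  have hiff : ∀ x, π x ∈ B ↔ x ∈ B := by
    intro x
    constructor
    · intro hx
      rw [← hπ] at hx
      obtain ⟨y, hy, hyx⟩ := Finset.mem_map.1 hx
      have : y = x := π.injective (by simpa using hyx)
      exact this ▸ hy
    · intro hx
      have : π x ∈ B.map π.toEmbedding := Finset.mem_map_of_mem _ hx
      rwa [hπ] at this
  have hiff' : ∀ x, ¬ (π x ∈ B) ↔ ¬ (x ∈ B) := fun x => not_congr (hiff x)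
  refine ⟨(π.subtypePerm hiff, π.subtypePerm hiff'), ?_⟩
  ext x
  by_cases hx : x ∈ B
  · simp [Equiv.Perm.subtypeCongrHom, Equiv.Perm.subtypeCongr.left_apply _ _ hx]
  · simp [Equiv.Perm.subtypeCongrHom, Equiv.Perm.subtypeCongr.right_apply _ _ hx]

/-- **Block descent** (setwise analogue of `UmvirateDescent`).  For blocks `B, P₁, P₂, P₃ ⊆ Fin n` of
the same size and a triple `S, T, U ⊆ 𝔖ₙ` with the triple product property, there is a triple in
`Perm B × Perm Bᶜ` (`≅ 𝔖_k × 𝔖_{n−k}`, `k = |B|`) with the triple product property whose cardinalities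
are those of the three BLOCK PIECES `{σ ∈ S : σ(P₁) = B}`, `{τ ∈ T : τ(P₂) = B}`, `{υ ∈ U : υ(P₃) = B}`
(a common TARGET block, arbitrary source blocks — exactly as for umvirates).  Proof: filter
(heredity), right-translate by `a, b, c` with `a(B) = P₁`, `b(B) = P₂`, `c(B) = P₃`
(`Equiv.Perm.exists_map_finset_eq`) into the setwise stabiliser of `B`, and pull back along the
injective block embedding (`exists_tripleProductProperty_pullback`, landed with `UmvirateDescent`).
[folklore; cf. BlasiakChurchCohnGrochowUmans2017, proof of Thm. 4.2] -/
theorem blockDescent {n : ℕ} (B P₁ P₂ P₃ : Finset (Fin n)) (h₁ : B.card = P₁.card)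
    (h₂ : B.card = P₂.card) (h₃ : B.card = P₃.card) {S T U : Finset (Equiv.Perm (Fin n))}
    (hTPP : TripleProductProperty S T U) :
    ∃ S' T' U' : Finset (Equiv.Perm {x // x ∈ B} × Equiv.Perm {x // ¬ x ∈ B}),
      TripleProductProperty S' T' U' ∧
      S'.card = (S.filter (fun σ => P₁.map σ.toEmbedding = B)).card ∧
      T'.card = (T.filter (fun σ => P₂.map σ.toEmbedding = B)).card ∧
      U'.card = (U.filter (fun σ => P₃.map σ.toEmbedding = B)).card := by
  classical
  obtain ⟨a, ha⟩ := Equiv.Perm.exists_map_finset_eq B P₁ h₁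
  obtain ⟨b, hb⟩ := Equiv.Perm.exists_map_finset_eq B P₂ h₂
  obtain ⟨c, hc⟩ := Equiv.Perm.exists_map_finset_eq B P₃ h₃
  have hψ := Equiv.Perm.subtypeCongrHom_injective (fun x : Fin n => x ∈ B)
  -- a filtered element times the matching translate stabilises `B` setwise
  have stab : ∀ (X : Finset (Equiv.Perm (Fin n))) (P : Finset (Fin n)) (g : Equiv.Perm (Fin n)),
      B.map g.toEmbedding = P → ∀ σ ∈ X.filter (fun σ => P.map σ.toEmbedding = B),
        σ * g ∈ Set.range (Equiv.Perm.subtypeCongrHom (· ∈ B)) := by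
    intro X P g hg σ hσ
    apply mem_range_subtypeCongrHom_of_map_eq
    have hσ' := (Finset.mem_filter.1 hσ).2
    have : (σ * g).toEmbedding = g.toEmbedding.trans σ.toEmbedding := by
      ext x; rfl
    rw [this, ← Finset.map_map, hg, hσ']
  exact exists_tripleProductProperty_pullback _ hψ a b c
    (hTPP.mono (Finset.filter_subset _ _) (Finset.filter_subset _ _) (Finset.filter_subset _ _))
    (stab S P₁ a ha) (stab T P₂ b hb) (stab U P₃ c hc)

/-- **Packing in a finite group, squared form**: a TPP triple `S, T, U` in a finite group `G` has
`(|S||T||U|)² ≤ |G|³` (the three pairwise bounds `|S||T|, |T||U|, |U||S| ≤ |G|` of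
`RealizesTPP.mul_le_card`, multiplied; if a set is empty the left side vanishes). [CohnUmans2003, Lemma 3.1] -/
theorem tpp_volume_sq_le {G : Type*} [Group G] [Fintype G] [DecidableEq G] {S T U : Finset G}
    (h : TripleProductProperty S T U) :
    (S.card * T.card * U.card) ^ 2 ≤ Fintype.card G ^ 3 := by
  by_cases h0 : S.card * T.card * U.card = 0
  · rw [h0]; simp
  have hS : S.card ≠ 0 := fun hz => h0 (by simp [hz])
  have hT : T.card ≠ 0 := fun hz => h0 (by simp [hz])
  have hU : U.card ≠ 0 := fun hz => h0 (by simp [hz])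
  have r1 : Literature.Computability.AlgebraicComplexity.RealizesTPP G S.card T.card U.card :=
    ⟨S, T, U, rfl, rfl, rfl, h⟩
  have r2 : Literature.Computability.AlgebraicComplexity.RealizesTPP G T.card U.card S.card :=
    ⟨T, U, S, rfl, rfl, rfl, h.rotate⟩
  have r3 : Literature.Computability.AlgebraicComplexity.RealizesTPP G U.card S.card T.card :=
    ⟨U, S, T, rfl, rfl, rfl, h.rotate.rotate⟩
  have e1 := r1.mul_le_card hU
  have e2 := r2.mul_le_card hS
  have e3 := r3.mul_le_card hT
  calc (S.card * T.card * U.card) ^ 2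
      = (S.card * T.card) * (T.card * U.card) * (U.card * S.card) := by ring
    _ ≤ Fintype.card G * Fintype.card G * Fintype.card G :=
        Nat.mul_le_mul (Nat.mul_le_mul e1 e2) e3
    _ = Fintype.card G ^ 3 := by ring

/-- **Block packing**: for a TPP triple `S, T, U ⊆ 𝔖ₙ` and blocks `B, P₁, P₂, P₃` of common size `k`,
the three block pieces with common target `B` satisfy
`(|{σ ∈ S : σ(P₁) = B}|·|{τ ∈ T : τ(P₂) = B}|·|{υ ∈ U : υ(P₃) = B}|)² ≤ (k!·(n−k)!)³`
(`blockDescent` + packing in `Perm B × Perm Bᶜ`, whose order is `k!(n−k)!`).  For the three full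
setwise stabiliser cosets this is `((k!(n−k)!)³)^{1/2} = (n!)^{3/2}/C(n,k)^{3/2}`. [folklore] -/
theorem blockPacking {n : ℕ} (B P₁ P₂ P₃ : Finset (Fin n)) (h₁ : B.card = P₁.card)
    (h₂ : B.card = P₂.card) (h₃ : B.card = P₃.card) {S T U : Finset (Equiv.Perm (Fin n))}
    (hTPP : TripleProductProperty S T U) :
    ((S.filter (fun σ => P₁.map σ.toEmbedding = B)).card *
      (T.filter (fun σ => P₂.map σ.toEmbedding = B)).card *
      (U.filter (fun σ => P₃.map σ.toEmbedding = B)).card) ^ 2 ≤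
      (B.card.factorial * (n - B.card).factorial) ^ 3 := by
  classical
  obtain ⟨S', T', U', hTPP', hS, hT, hU⟩ := blockDescent B P₁ P₂ P₃ h₁ h₂ h₃ hTPP
  rw [← hS, ← hT, ← hU]
  have key := tpp_volume_sq_le hTPP'
  have hcard : Fintype.card (Equiv.Perm {x // x ∈ B} × Equiv.Perm {x // ¬ x ∈ B}) =
      B.card.factorial * (n - B.card).factorial := by
    rw [Fintype.card_prod, Fintype.card_perm, Fintype.card_perm, Fintype.card_coe]
    congr 2
    rw [Fintype.card_subtype_compl, Fintype.card_fin, Fintype.card_coe]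
  rwa [hcard] at key

/-- **Stub `stub_blockDescent`** (crux stmt-MatrixMultiplication-8303, registered by the lead of seat c4 as a
tool for the successor line: the setwise analogue of the route support `UmvirateDescent`).  For blocks
`B, P₁, P₂, P₃ ⊆ Fin n` of one size and a TPP triple `S, T, U ⊆ 𝔖ₙ`, the three block pieces
`{σ ∈ S : σ(P₁) = B}`, `{τ ∈ T : τ(P₂) = B}`, `{υ ∈ U : υ(P₃) = B}` (common TARGET block `B`) are the
cardinalities of a TPP triple in `Perm B × Perm Bᶜ ≅ 𝔖_{|B|} × 𝔖_{n−|B|}` (`blockDescent`). [folklore] -/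
theorem stub_blockDescent : ∀ (n : ℕ) (B P₁ P₂ P₃ : Finset (Fin n)), B.card = P₁.card → B.card = P₂.card → B.card = P₃.card → ∀ S T U : Finset (Equiv.Perm (Fin n)), Literature.Combinatorics.Additive.TripleProductProperty S T U → ∃ S' T' U' : Finset (Equiv.Perm {x // x ∈ B} × Equiv.Perm {x // ¬ x ∈ B}), Literature.Combinatorics.Additive.TripleProductProperty S' T' U' ∧ S'.card = (S.filter (fun σ => P₁.map σ.toEmbedding = B)).card ∧ T'.card = (T.filter (fun σ => P₂.map σ.toEmbedding = B)).card ∧ U'.card = (U.filter (fun σ => P₃.map σ.toEmbedding = B)).card :=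
  fun _ B P₁ P₂ P₃ h₁ h₂ h₃ _ _ _ hTPP => blockDescent B P₁ P₂ P₃ h₁ h₂ h₃ hTPP

/-- **Stub `stub_blockPacking`** (crux stmt-MatrixMultiplication-8303, registered by the lead of seat c4 as a
tool for the successor line).  For blocks `B, P₁, P₂, P₃ ⊆ Fin n` of one size `k` and a TPP triple
`S, T, U ⊆ 𝔖ₙ`: `(|{σ ∈ S : σ(P₁) = B}|·|{τ ∈ T : τ(P₂) = B}|·|{υ ∈ U : υ(P₃) = B}|)² ≤ (k!(n−k)!)³` —
the block pieces with a common target cannot all be large (`blockPacking`).  For three full setwise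
stabiliser cosets the bound is attained up to the exponent: volume `(k!(n−k)!)³ = (n!)³/C(n,k)³` against
the bound `(k!(n−k)!)^{3/2} = (n!)^{3/2}/C(n,k)^{3/2}`. [folklore] -/
theorem stub_blockPacking : ∀ (n : ℕ) (B P₁ P₂ P₃ : Finset (Fin n)), B.card = P₁.card → B.card = P₂.card → B.card = P₃.card → ∀ S T U : Finset (Equiv.Perm (Fin n)), Literature.Combinatorics.Additive.TripleProductProperty S T U → ((S.filter (fun σ => P₁.map σ.toEmbedding = B)).card * (T.filter (fun σ => P₂.map σ.toEmbedding = B)).card * (U.filter (fun σ => P₃.map σ.toEmbedding = B)).card) ^ 2 ≤ (B.card.factorial * (n - B.card).factorial) ^ 3 :=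
  fun _ B P₁ P₂ P₃ h₁ h₂ h₃ _ _ _ hTPP => blockPacking B P₁ P₂ P₃ h₁ h₂ h₃ hTPP

end Summit.MatrixMultiplication.MatrixMultiplication.Theorems.GlobalBranch
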